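import Summits.CriticalPhenomena.PercolationContinuityZ3.Theorems.PercNearOneGluingNoHeavyLowerTailQuantitativeCovDTiltIdentity
import HarnessLib

/-!
# The ONE-PAIR expansion of the conditioned vdBHK covariance and the first-order reduction of BENCH row M2-R52:
# `covD = Cov_ν(F,G) − t·M + t²·Q`, hence `M ≥ 0 ⟹ covD ≤ Cov_ν(F,G)`

Support file (`--supports stmt-CriticalPhenomena-4575`), prover seat `prim-rate-mine-2` (lane prim-rate, constants-miner (c), BENCH row M2-R52;
`run/shared/lean/prim/prim-rate/prim-rate-mine-2/PROOFS.md` §P50 (e), §P52 (b)).  No definitions, no named facts, no sorries; standard axioms.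

Take `Y = {y}` and suppose the only pair at `y` of positive weight is `{a, y}`, of weight `t = w{a,y}`.  With `ν = μ_{w_Y}` (the pair deleted),
`F = f(𝒞_x)`, `G = χ_u(𝒞_x) = 1{u ∈ V(𝒞_x)}`, `T = χ_a(𝒞_x) = 1{a ∈ V(𝒞_x)}` and `E = E_ν`, the tilt weight of `CSH.covD_eq_tilt` is `1 − t·T`
(`CSH.tilt_onePair_eq`, on the `ν`-almost sure event «no open pair at `y`»), so
* **`CSH.covD_onePair_eq`** — `covD w x {y} f u = (E[FG] − E F·E G) − t·M + t²·Q` EXACTLY, with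
  `M = E[TFG] + E T·E[FG] − E F·E[TG] − E G·E[TF]` (the bracket of conjecture (K_a), BENCH l.182) and `Q = E T·E[TFG] − E[TF]·E[TG]`
  — the first-order criterion of PROOFS §P50 (e) made exact to all orders for one pair;
* **`CSH.covD_le_cov_of_bracket_nonneg`** — if `f` is monotone `≥ 0` and `M ≥ 0`, then `covD w x {y} f u ≤ E[FG] − E F·E G` (whatever
  `t ∈ [0,1]`): the door R1 of BENCH l.175 holds at this instance (case `Q ≤ 0`: trivially; case `Q > 0`:
  `E T·(M − Q) = (E T)²·Cov_ν(F,G) + (1 − E T)·Q + (E[TF] − E T·E F)(E[TG] − E T·E G) ≥ 0` by Harris under `ν`, so `t²Q ≤ tQ ≤ tM`).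
So for a single `Y`-pair, R1 is EQUIVALENT to `M ≥ 0` at the instance; (K_a) asserts `M ≥ 0` for vertex-monotone `f` (census-alive and sharp, BENCH
l.182); it FAILS for pair functionals (BENCH l.176/l.181) — which is exactly how the doors R1…R3 die there.
[cite: VandenbergHaggstromKahn2005, Thm. 1.3 (p. 6), §2.1 Lemma 2.3 (p. 10)] [cite: Harris1960, Lemma 4.1 (p. 16)]
-/

noncomputable section

namespace Summit.CriticalPhenomena.PercolationContinuityZ3.Theorems.CSH

open MeasureTheory Set unitInterval
open Literature.Probability.LatticeModels (prodBernoulli prodBernoulli_real_forall_notMem)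
open Literature.Probability.Percolation
open Literature.Probability.Percolation.BHK2006 (openEdgeCluster_mono)
open scoped Classical

variable {V : Type*} [Fintype V]

/-- Harris' inequality for two nonnegative monotone functions of the configuration under `prodBernoulli w` (read off the
influence-product floor). [cite: Harris1960, Lemma 4.1 (p. 16)] -/
private theorem integral_mul_integral_le_integral_mul₇ (w : Sym2 V → unitInterval) (e0 : Sym2 V) (F G : Set (Sym2 V) → ℝ)
    (hF0 : ∀ ω, 0 ≤ F ω) (hG0 : ∀ ω, 0 ≤ G ω) (hF : Monotone F) (hG : Monotone G) :
    (∫ ω, F ω ∂(prodBernoulli w)) * (∫ ω, G ω ∂(prodBernoulli w)) ≤ ∫ ω, F ω * G ω ∂(prodBernoulli w) := by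
  have h := QuantHarris.influence_mul_influence_le_cov_prodBernoulli w e0 F G hF0 hG0 hF hG
  have hl : 0 ≤ (w e0 : ℝ) * (1 - w e0) *
      ((∫ ω, (F (insert e0 ω) - F (ω \ {e0})) ∂(prodBernoulli w)) *
        ∫ ω, (G (insert e0 ω) - G (ω \ {e0})) ∂(prodBernoulli w)) := by
    refine mul_nonneg (mul_nonneg (w e0).2.1 (sub_nonneg.2 (w e0).2.2)) (mul_nonneg ?_ ?_)
    · exact integral_nonneg fun ω => sub_nonneg.2 (hF (Set.sdiff_subset.trans (Set.subset_insert e0 ω)))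
    · exact integral_nonneg fun ω => sub_nonneg.2 (hG (Set.sdiff_subset.trans (Set.subset_insert e0 ω)))
  linarith

/-! ### The tilt weight for one pair -/

omit [Fintype V] in
/-- `χ_a(𝒞) ∈ {0, 1}` and is nonnegative. [folklore] -/
private theorem connIndicatorFn_nonneg₇ (x a : V) (C : Set (Sym2 V)) : 0 ≤ connIndicatorFn x a C := by
  unfold connIndicatorFn; split_ifs; exacts [zero_le_one, le_rfl]

/-- **The tilt weight for `Y = {y}` with a single weighted pair `{a, y}`**: on every configuration without open pairs at `y`,
`∏_{e ∋ y, e meets V(𝒞_x) ∪ {x}} (1 − w_e) = 1 − w{a,y}·χ_a(𝒞_x)`. [folklore] -/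
theorem tilt_onePair_eq (w : Sym2 V → unitInterval) {x a y : V} (hxy : x ≠ y) (hw0 : ∀ c, c ≠ a → w s(c, y) = 0)
    {η : BondConfig V} (hη : ∀ e ∈ η, y ∉ e) :
    (∏ e ∈ Finset.univ.filter (fun e : Sym2 V => (∃ y' ∈ ({y} : Set V), y' ∈ e) ∧
        ∃ c ∈ e, c = x ∨ ∃ e' ∈ openEdgeCluster η x, c ∈ e'), (1 - (w e : ℝ))) =
      1 - (w s(a, y) : ℝ) * connIndicatorFn x a (openEdgeCluster η x) := by
  set P : Finset (Sym2 V) := Finset.univ.filter (fun e : Sym2 V => (∃ y' ∈ ({y} : Set V), y' ∈ e) ∧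
        ∃ c ∈ e, c = x ∨ ∃ e' ∈ openEdgeCluster η x, c ∈ e') with hP
  have hyC : ∀ e' ∈ openEdgeCluster η x, y ∉ e' := fun e' he' => hη e' (openEdgeCluster_subset η x he')
  have hone : ∀ e ∈ P, e ≠ s(a, y) → (1 - (w e : ℝ)) = 1 := by
    intro e he hne
    simp only [hP, Finset.mem_filter, Finset.mem_univ, true_and, Set.mem_singleton_iff, exists_eq_left] at he
    obtain ⟨c, hc⟩ := Sym2.mem_iff_exists.1 he.1
    have hca : c ≠ a := fun h => hne (by rw [hc, h, Sym2.eq_swap])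
    have h0 : w e = 0 := by rw [hc, Sym2.eq_swap]; exact hw0 c hca
    rw [h0]; simp
  by_cases hmem : s(a, y) ∈ P
  · rw [Finset.prod_eq_single_of_mem (s(a, y)) hmem (fun e he hne => hone e he hne)]
    have ha : a = x ∨ ∃ e' ∈ openEdgeCluster η x, a ∈ e' := by
      simp only [hP, Finset.mem_filter, Finset.mem_univ, true_and] at hmem
      obtain ⟨c, hc, hcx⟩ := hmem.2
      rcases Sym2.mem_iff.1 hc with rfl | rfl
      · exact hcx
      · rcases hcx with h | ⟨e', he', hce'⟩
        · exact absurd h.symm hxy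
        · exact absurd hce' (hyC e' he')
    unfold connIndicatorFn
    rw [if_pos ha, mul_one]
  · rw [Finset.prod_eq_one (fun e he => hone e he (fun h => hmem (h ▸ he)))]
    have ha : ¬ (a = x ∨ ∃ e' ∈ openEdgeCluster η x, a ∈ e') := by
      intro h
      apply hmem
      simp only [hP, Finset.mem_filter, Finset.mem_univ, true_and, Set.mem_singleton_iff, exists_eq_left]
      exact ⟨Sym2.mem_mk_right a y, a, Sym2.mem_mk_left a y, h⟩
    unfold connIndicatorFn
    rw [if_neg ha, mul_zero, sub_zero]

/-- Under `μ_{w_Y}` (`Y = {y}`) almost surely no open pair meets `y`. [folklore] -/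
theorem ae_forall_notMem_pairsAt (w : Sym2 V → unitInterval) (y : V) :
    ∀ᵐ η ∂(prodBernoulli fun e => if (∃ y' ∈ ({y} : Set V), y' ∈ e) then (0 : unitInterval) else w e), ∀ e ∈ η, y ∉ e := by
  set wY : Sym2 V → unitInterval := fun e => if (∃ y' ∈ ({y} : Set V), y' ∈ e) then (0 : unitInterval) else w e with hwY
  set ν := prodBernoulli wY with hν
  set MY : Finset (Sym2 V) := Finset.univ.filter (fun e : Sym2 V => y ∈ e) with hMY
  have hmeas : ∀ T : Set (BondConfig V), MeasurableSet T := fun _ => MeasurableSet.of_discrete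
  have h1 : ν.real {η | ∀ e ∈ MY, e ∉ η} = 1 := by
    rw [prodBernoulli_real_forall_notMem wY MY]
    refine Finset.prod_eq_one fun e he => ?_
    have hye : y ∈ e := by simpa [hMY] using he
    have : wY e = 0 := by simp only [hwY]; exact if_pos ⟨y, rfl, hye⟩
    rw [this]; simp
  have h0 : ν {η | ∀ e ∈ MY, e ∉ η}ᶜ = 0 := by
    rw [← measureReal_eq_zero_iff, measureReal_compl (hmeas _), probReal_univ, h1, sub_self]
  filter_upwards [measure_eq_zero_iff_ae_notMem.1 h0] with η hη
  intro e he hye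
  simp only [Set.mem_compl_iff, Set.mem_setOf_eq, not_forall, not_not] at hη
  push Not at hη
  exact hη e (by simpa [hMY] using hye) he

/-! ### The one-pair expansion -/

/-- **One-pair expansion of the conditioned vdBHK covariance.**  ANY weights with the only weighted pair at `y` being `{a,y}` (`t = w{a,y}`),
`x ≠ y`, any `f`, any `u`; `ν = μ_{w_{{y}}}`, `F = f(𝒞_x)`, `G = χ_u(𝒞_x)`, `T = χ_a(𝒞_x)`:
`covD w x {y} f u = (E[FG] − E F·E G) − t·(E[TFG] + E T·E[FG] − E F·E[TG] − E G·E[TF]) + t²·(E T·E[TFG] − E[TF]·E[TG])`.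
[cite: VandenbergHaggstromKahn2005, Thm. 1.3 (p. 6), §2.1 Lemma 2.3 (p. 10)] -/
theorem covD_onePair_eq (w : Sym2 V → unitInterval) (x a y u : V) (hxy : x ≠ y) (hw0 : ∀ c, c ≠ a → w s(c, y) = 0)
    (f : Set (Sym2 V) → ℝ) :
    covD w x {y} f u =
      ((∫ η, f (openEdgeCluster η x) * connIndicatorFn x u (openEdgeCluster η x)
          ∂(prodBernoulli fun e => if (∃ y' ∈ ({y} : Set V), y' ∈ e) then (0 : unitInterval) else w e)) -
        (∫ η, f (openEdgeCluster η x) ∂(prodBernoulli fun e => if (∃ y' ∈ ({y} : Set V), y' ∈ e) then (0 : unitInterval) else w e)) *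
        (∫ η, connIndicatorFn x u (openEdgeCluster η x)
          ∂(prodBernoulli fun e => if (∃ y' ∈ ({y} : Set V), y' ∈ e) then (0 : unitInterval) else w e))) -
      (w s(a, y) : ℝ) *
        ((∫ η, connIndicatorFn x a (openEdgeCluster η x) * (f (openEdgeCluster η x) * connIndicatorFn x u (openEdgeCluster η x))
            ∂(prodBernoulli fun e => if (∃ y' ∈ ({y} : Set V), y' ∈ e) then (0 : unitInterval) else w e)) +
          (∫ η, connIndicatorFn x a (openEdgeCluster η x)
            ∂(prodBernoulli fun e => if (∃ y' ∈ ({y} : Set V), y' ∈ e) then (0 : unitInterval) else w e)) *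
          (∫ η, f (openEdgeCluster η x) * connIndicatorFn x u (openEdgeCluster η x)
            ∂(prodBernoulli fun e => if (∃ y' ∈ ({y} : Set V), y' ∈ e) then (0 : unitInterval) else w e)) -
          (∫ η, f (openEdgeCluster η x) ∂(prodBernoulli fun e => if (∃ y' ∈ ({y} : Set V), y' ∈ e) then (0 : unitInterval) else w e)) *
          (∫ η, connIndicatorFn x a (openEdgeCluster η x) * connIndicatorFn x u (openEdgeCluster η x)
            ∂(prodBernoulli fun e => if (∃ y' ∈ ({y} : Set V), y' ∈ e) then (0 : unitInterval) else w e)) -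
          (∫ η, connIndicatorFn x u (openEdgeCluster η x)
            ∂(prodBernoulli fun e => if (∃ y' ∈ ({y} : Set V), y' ∈ e) then (0 : unitInterval) else w e)) *
          (∫ η, connIndicatorFn x a (openEdgeCluster η x) * f (openEdgeCluster η x)
            ∂(prodBernoulli fun e => if (∃ y' ∈ ({y} : Set V), y' ∈ e) then (0 : unitInterval) else w e))) +
      (w s(a, y) : ℝ) ^ 2 *
        ((∫ η, connIndicatorFn x a (openEdgeCluster η x)
            ∂(prodBernoulli fun e => if (∃ y' ∈ ({y} : Set V), y' ∈ e) then (0 : unitInterval) else w e)) *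
          (∫ η, connIndicatorFn x a (openEdgeCluster η x) * (f (openEdgeCluster η x) * connIndicatorFn x u (openEdgeCluster η x))
            ∂(prodBernoulli fun e => if (∃ y' ∈ ({y} : Set V), y' ∈ e) then (0 : unitInterval) else w e)) -
          (∫ η, connIndicatorFn x a (openEdgeCluster η x) * f (openEdgeCluster η x)
            ∂(prodBernoulli fun e => if (∃ y' ∈ ({y} : Set V), y' ∈ e) then (0 : unitInterval) else w e)) *
          (∫ η, connIndicatorFn x a (openEdgeCluster η x) * connIndicatorFn x u (openEdgeCluster η x)
            ∂(prodBernoulli fun e => if (∃ y' ∈ ({y} : Set V), y' ∈ e) then (0 : unitInterval) else w e))) := by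
  have hxY : x ∉ ({y} : Set V) := by simpa using hxy
  rw [covD_eq_tilt w x {y} hxY f u]
  set ν := prodBernoulli (fun e => if (∃ y' ∈ ({y} : Set V), y' ∈ e) then (0 : unitInterval) else w e) with hν
  set t : ℝ := (w s(a, y) : ℝ) with ht
  set F : BondConfig V → ℝ := fun η => f (openEdgeCluster η x) with hF
  set G : BondConfig V → ℝ := fun η => connIndicatorFn x u (openEdgeCluster η x) with hG
  set T : BondConfig V → ℝ := fun η => connIndicatorFn x a (openEdgeCluster η x) with hT
  set h : BondConfig V → ℝ := fun η => ∏ e ∈ Finset.univ.filter (fun e : Sym2 V => (∃ y' ∈ ({y} : Set V), y' ∈ e) ∧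
        ∃ c ∈ e, c = x ∨ ∃ e' ∈ openEdgeCluster η x, c ∈ e'), (1 - (w e : ℝ)) with hh
  -- `h = 1 − t·T` almost surely
  have hae : ∀ᵐ η ∂ν, h η = 1 - t * T η :=
    (ae_forall_notMem_pairsAt w y).mono fun η hη => tilt_onePair_eq w hxy hw0 hη
  -- the four tilted integrals
  have key : ∀ X : BondConfig V → ℝ, ∫ η, h η * X η ∂ν = (∫ η, X η ∂ν) - t * ∫ η, T η * X η ∂ν := by
    intro X
    have e1 : ∫ η, h η * X η ∂ν = ∫ η, (X η - t * (T η * X η)) ∂ν :=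
      integral_congr_ae (hae.mono fun η hη => by simp only [hη]; ring)
    rw [e1, integral_sub (Integrable.of_finite) (Integrable.of_finite), integral_const_mul]
  have k1 := key (fun _ => (1 : ℝ))
  have k2 := key (fun η => F η * G η)
  have k3 := key F
  have k4 := key G
  simp only [mul_one] at k1
  have hone : ∫ η, (fun _ : BondConfig V => (1 : ℝ)) η ∂ν = 1 := by simp [integral_const, probReal_univ]
  rw [hone] at k1
  show (∫ η, h η * 1 ∂ν) * (∫ η, h η * (F η * G η) ∂ν) - (∫ η, h η * F η ∂ν) * (∫ η, h η * G η ∂ν) =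
    ((∫ η, F η * G η ∂ν) - (∫ η, F η ∂ν) * (∫ η, G η ∂ν)) -
      t * ((∫ η, T η * (F η * G η) ∂ν) + (∫ η, T η ∂ν) * (∫ η, F η * G η ∂ν) - (∫ η, F η ∂ν) * (∫ η, T η * G η ∂ν) -
            (∫ η, G η ∂ν) * (∫ η, T η * F η ∂ν)) +
      t ^ 2 * ((∫ η, T η ∂ν) * (∫ η, T η * (F η * G η) ∂ν) - (∫ η, T η * F η ∂ν) * (∫ η, T η * G η ∂ν))
  have k1' : ∫ η, h η * 1 ∂ν = 1 - t * ∫ η, T η ∂ν := by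
    simp only [mul_one]; exact k1
  rw [k1', k2, k3, k4]
  ring

/-! ### The first-order reduction: `M ≥ 0 ⟹ R1` for one pair -/

/-- **Reduction of the door R1 to the sign of the (K_a) bracket, one `Y`-pair.**  Same setting, `f` monotone `≥ 0`; if
`M = E[TFG] + E T·E[FG] − E F·E[TG] − E G·E[TF] ≥ 0` then `covD w x {y} f u ≤ E[FG] − E F·E G = Cov_ν(f(𝒞_x), 1{x↔u})` — for every value
of the pair weight `t ∈ [0,1]`. [cite: VandenbergHaggstromKahn2005, Thm. 1.3 (p. 6)] [cite: Harris1960, Lemma 4.1 (p. 16)] -/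
theorem covD_le_cov_of_bracket_nonneg (w : Sym2 V → unitInterval) (x a y u : V) (hxy : x ≠ y) (hw0 : ∀ c, c ≠ a → w s(c, y) = 0)
    (f : Set (Sym2 V) → ℝ) (hf : Monotone f) (hf0 : ∀ C, 0 ≤ f C)
    (hM : 0 ≤ (∫ η, connIndicatorFn x a (openEdgeCluster η x) * (f (openEdgeCluster η x) * connIndicatorFn x u (openEdgeCluster η x))
            ∂(prodBernoulli fun e => if (∃ y' ∈ ({y} : Set V), y' ∈ e) then (0 : unitInterval) else w e)) +
          (∫ η, connIndicatorFn x a (openEdgeCluster η x)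
            ∂(prodBernoulli fun e => if (∃ y' ∈ ({y} : Set V), y' ∈ e) then (0 : unitInterval) else w e)) *
          (∫ η, f (openEdgeCluster η x) * connIndicatorFn x u (openEdgeCluster η x)
            ∂(prodBernoulli fun e => if (∃ y' ∈ ({y} : Set V), y' ∈ e) then (0 : unitInterval) else w e)) -
          (∫ η, f (openEdgeCluster η x) ∂(prodBernoulli fun e => if (∃ y' ∈ ({y} : Set V), y' ∈ e) then (0 : unitInterval) else w e)) *
          (∫ η, connIndicatorFn x a (openEdgeCluster η x) * connIndicatorFn x u (openEdgeCluster η x)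
            ∂(prodBernoulli fun e => if (∃ y' ∈ ({y} : Set V), y' ∈ e) then (0 : unitInterval) else w e)) -
          (∫ η, connIndicatorFn x u (openEdgeCluster η x)
            ∂(prodBernoulli fun e => if (∃ y' ∈ ({y} : Set V), y' ∈ e) then (0 : unitInterval) else w e)) *
          (∫ η, connIndicatorFn x a (openEdgeCluster η x) * f (openEdgeCluster η x)
            ∂(prodBernoulli fun e => if (∃ y' ∈ ({y} : Set V), y' ∈ e) then (0 : unitInterval) else w e))) :
    covD w x {y} f u ≤
      (∫ η, f (openEdgeCluster η x) * connIndicatorFn x u (openEdgeCluster η x)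
          ∂(prodBernoulli fun e => if (∃ y' ∈ ({y} : Set V), y' ∈ e) then (0 : unitInterval) else w e)) -
        (∫ η, f (openEdgeCluster η x) ∂(prodBernoulli fun e => if (∃ y' ∈ ({y} : Set V), y' ∈ e) then (0 : unitInterval) else w e)) *
        (∫ η, connIndicatorFn x u (openEdgeCluster η x)
          ∂(prodBernoulli fun e => if (∃ y' ∈ ({y} : Set V), y' ∈ e) then (0 : unitInterval) else w e)) := by
  rw [covD_onePair_eq w x a y u hxy hw0 f]
  set ν := prodBernoulli (fun e => if (∃ y' ∈ ({y} : Set V), y' ∈ e) then (0 : unitInterval) else w e) with hν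
  set t : ℝ := (w s(a, y) : ℝ) with ht
  set F : BondConfig V → ℝ := fun η => f (openEdgeCluster η x) with hF
  set G : BondConfig V → ℝ := fun η => connIndicatorFn x u (openEdgeCluster η x) with hG
  set T : BondConfig V → ℝ := fun η => connIndicatorFn x a (openEdgeCluster η x) with hT
  have ht0 : 0 ≤ t := (w s(a, y)).2.1
  have ht1 : t ≤ 1 := (w s(a, y)).2.2
  -- monotonicity / nonnegativity of the three cluster functionals
  have hF0 : ∀ η, 0 ≤ F η := fun η => hf0 _
  have hG0 : ∀ η, 0 ≤ G η := fun η => connIndicatorFn_nonneg₇ x u _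
  have hT0 : ∀ η, 0 ≤ T η := fun η => connIndicatorFn_nonneg₇ x a _
  have hFm : Monotone F := fun η η' hle => hf (openEdgeCluster_mono hle x)
  have hGm : Monotone G := fun η η' hle => monotone_connIndicatorFn x u (openEdgeCluster_mono hle x)
  have hTm : Monotone T := fun η η' hle => monotone_connIndicatorFn x a (openEdgeCluster_mono hle x)
  have hTle : ∀ η, T η ≤ 1 := fun η => by
    simp only [hT]; unfold connIndicatorFn; split_ifs; exacts [le_rfl, zero_le_one]
  have hTFm : Monotone (fun η => T η * F η) := fun η η' hle => mul_le_mul (hTm hle) (hFm hle) (hF0 _) (hT0 _)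
  have hTF0 : ∀ η, 0 ≤ T η * F η := fun η => mul_nonneg (hT0 η) (hF0 η)
  obtain ⟨e0⟩ : Nonempty (Sym2 V) := ⟨s(x, x)⟩
  -- Harris under `ν`
  have hCov : (∫ η, F η ∂ν) * (∫ η, G η ∂ν) ≤ ∫ η, F η * G η ∂ν :=
    integral_mul_integral_le_integral_mul₇ _ e0 F G hF0 hG0 hFm hGm
  have hα : (∫ η, T η ∂ν) * (∫ η, F η ∂ν) ≤ ∫ η, T η * F η ∂ν :=
    integral_mul_integral_le_integral_mul₇ _ e0 T F hT0 hF0 hTm hFm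
  have hβ : (∫ η, T η ∂ν) * (∫ η, G η ∂ν) ≤ ∫ η, T η * G η ∂ν :=
    integral_mul_integral_le_integral_mul₇ _ e0 T G hT0 hG0 hTm hGm
  -- `0 ≤ E T ≤ 1`, `0 ≤ E[TF]`, `0 ≤ E[TG]`, `E[TFG] ≥ 0`
  have hp0 : 0 ≤ ∫ η, T η ∂ν := integral_nonneg hT0
  have hp1 : ∫ η, T η ∂ν ≤ 1 := by
    have h1 : ∫ η, T η ∂ν ≤ ∫ η, (1 : ℝ) ∂ν := integral_mono (Integrable.of_finite) (Integrable.of_finite) hTle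
    simpa [integral_const, probReal_univ] using h1
  have hTF : 0 ≤ ∫ η, T η * F η ∂ν := integral_nonneg hTF0
  have hTG : 0 ≤ ∫ η, T η * G η ∂ν := integral_nonneg fun η => mul_nonneg (hT0 η) (hG0 η)
  have hTFG : 0 ≤ ∫ η, T η * (F η * G η) ∂ν := integral_nonneg fun η => mul_nonneg (hT0 η) (mul_nonneg (hF0 η) (hG0 η))
  -- abbreviate the reals
  set p := ∫ η, T η ∂ν with hp
  set eFG := ∫ η, F η * G η ∂ν
  set eF := ∫ η, F η ∂ν
  set eG := ∫ η, G η ∂ν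
  set eTFG := ∫ η, T η * (F η * G η) ∂ν
  set eTF := ∫ η, T η * F η ∂ν
  set eTG := ∫ η, T η * G η ∂ν
  change 0 ≤ eTFG + p * eFG - eF * eTG - eG * eTF at hM
  show (eFG - eF * eG) - t * (eTFG + p * eFG - eF * eTG - eG * eTF) + t ^ 2 * (p * eTFG - eTF * eTG) ≤ eFG - eF * eG
  set M := eTFG + p * eFG - eF * eTG - eG * eTF with hMdef
  set Q := p * eTFG - eTF * eTG with hQdef
  by_cases hQ : Q ≤ 0
  · nlinarith [mul_nonneg ht0 hM, mul_nonneg (sq_nonneg t) (neg_nonneg.2 hQ)]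
  · push Not at hQ
    -- `p · (M − Q) = p²·Cov + (1 − p)·Q + α·β ≥ 0`, and `p > 0` since `Q > 0`
    have hid : p * (M - Q) = p ^ 2 * (eFG - eF * eG) + (1 - p) * Q + (eTF - p * eF) * (eTG - p * eG) := by
      simp only [hMdef, hQdef]; ring
    have hpMQ : 0 ≤ p * (M - Q) := by
      rw [hid]
      refine add_nonneg (add_nonneg (mul_nonneg (sq_nonneg p) (sub_nonneg.2 hCov)) (mul_nonneg (sub_nonneg.2 hp1) hQ.le)) ?_
      exact mul_nonneg (sub_nonneg.2 hα) (sub_nonneg.2 hβ)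
    have hppos : 0 < p := by
      rcases hp0.lt_or_eq with h | h
      · exact h
      · exfalso
        have : Q = - (eTF * eTG) := by simp only [hQdef, ← h]; ring
        rw [this] at hQ
        linarith [mul_nonneg hTF hTG]
    have hMQ : Q ≤ M := by
      have := (mul_nonneg_iff_of_pos_left hppos).1 hpMQ
      linarith
    nlinarith [mul_nonneg ht0 (sub_nonneg.2 hMQ), mul_nonneg (mul_nonneg ht0 (sub_nonneg.2 ht1)) hQ.le]

end Summit.CriticalPhenomena.PercolationContinuityZ3.Theorems.CSH

end
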